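import Mathlib
import Summits.KontsevichZagierPeriods.Zeta5Search.Families.BasicGrowthMaximum
import Summits.KontsevichZagierPeriods.Zeta5Search.Families.BasicGrowthScaling
import HarnessLib

/-!
# ζ(5) search — Families: a maximiser satisfies the SCALING EQUATIONS — strong capacity duality `M_σ = min_B ∏ B^B`

HONEST FRAMING: systematic search; no irrationality claim unless certified.  STRUCTURAL facts about the size of
Brown's basic cellular integrals [Brown2016, §1.5 (1.3)–(1.4)] (seat P2, Families layer); nothing about the
arithmetic of any zeta value.

`Families/BasicGrowthMaximum.lean`: for a bijective convergent seating the growth constant `M_σ = sup_S f_σ` is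
attained at some `t* ∈ S`.  `Families/BasicGrowthScaling.lean`: a point satisfying the scaling (Sinkhorn) equations
`IsScaling σ t : ∀ w, Σ_{e ∋ w} g_w/len_e = 1` realises `M_σ` and its plan attains the weak-duality bound.  This file
closes the circle with the CALCULUS step:
* `gapF σ g = ∏_w g_w / ∏_e Σ_{w ∈ span e} g_w` — Brown's function as a function of a free POSITIVE gap vector
  (`fSigma_eq_gapF`); it is homogeneous of degree `0` (`gapF_smul`: `ℓ + 1` gaps against `ℓ + 1` finite edges) and
  every positive gap vector is realised, after normalisation, by a point of the simplex (`exists_gapN_eq_div`), so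
  `gapF ≤ M_σ` on the whole open orthant (`gapF_le_fSup`);
* **`isScaling_of_fSigma_eq_fSup`** — at a maximiser `t*` the scaling equations hold: vary ONE gap `g_{w₀} ↦ x`
  (leaving the simplex, which homogeneity permits), the one-variable function
  `ψ(x) = log x + Σ_{w ≠ w₀} log g_w − Σ_e log(a_e x + R_e)` (`a_e = [w₀ ∈ span e]`) is `log gapF` there, has a local
  maximum at `x₀ = g_{w₀}`, and Fermat (`IsLocalMax.hasDerivAt_eq_zero`) gives `1/x₀ = Σ_{e ∋ w₀} 1/len_e`;
* `isScaling_iff_fSigma_eq_fSup` — maximisers are exactly the scaling points; **`exists_isScaling`** — hence every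
  bijective CONVERGENT seating has a scaling point, and
* **`exists_realTransport_eq_fSup`** / `exists_realTransport_exp_eq_fSup` — STRONG CAPACITY DUALITY:
  there is an admissible real transport plan `x` (non-negative, supported on (finite edge, spanned gap), unit row and
  column sums) with `∏_{i,w} x^x = M_σ`; combined with weak duality, `M_σ = min_x ∏ x^x = exp(−max_x H(x))`.
This is the variational description of the decay rate of Brown's basic cellular integrals observed numerically in
`HOME/pub-zeta5-p2/g4/` (Sinkhorn scaling), now a theorem for every convergent configuration.  Standard axioms only.
-/

noncomputable section

open MeasureTheory Set Finset Filter Topology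

namespace Summit.KontsevichZagierPeriods.Zeta5Search.Families.Cellular

variable {ℓ : ℕ} (σ : Fin (ℓ + 3) → Fin (ℓ + 3))

/-! ### Brown's function on free gap vectors -/

/-- Brown's function as a function of a free gap vector: `∏_w g_w / ∏_e Σ_{w ∈ span e} g_w` (finite `σδ⁰`-edges). -/
def gapF (hσi : Function.Injective σ) (g : Fin (ℓ + 1) → ℝ) : ℝ :=
  (∏ w, g w) / ∏ e : SEdge σ, ∑ w ∈ (cellEdges σ hσi).span (Sum.inr e), g w

/-- On the open simplex `f_σ(t) = gapF (gaps of t)`. -/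
theorem fSigma_eq_gapF (hσ : Function.Bijective σ) {t : Fin ℓ → ℝ} (ht : t ∈ openSimplex ℓ) :
    fSigma σ t = gapF σ hσ.1 (fun w => gapN t w) := by
  unfold fSigma gapF
  rw [prod_ef_succ_eq_prod_gapN, formDen_eq_prod_len σ hσ ht]
  congr 1
  exact Finset.prod_congr rfl fun e _ => (cellEdges σ hσ.1).len_eq_sum_gap t _

/-- `gapF` is positive on positive gap vectors. -/
theorem gapF_pos (hσi : Function.Injective σ) {g : Fin (ℓ + 1) → ℝ} (hg : ∀ w, 0 < g w) : 0 < gapF σ hσi g :=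
  div_pos (Finset.prod_pos fun w _ => hg w)
    (Finset.prod_pos fun _ _ => Finset.sum_pos (fun w _ => hg w) ((cellEdges σ hσi).span_nonempty _))

/-- **Homogeneity of degree `0`**: `gapF (c · g) = gapF g` for `c ≠ 0` (there are as many gaps as finite edges). -/
theorem gapF_smul (hσ : Function.Bijective σ) {c : ℝ} (hc : c ≠ 0) (g : Fin (ℓ + 1) → ℝ) :
    gapF σ hσ.1 (fun w => c * g w) = gapF σ hσ.1 g := by
  unfold gapF
  have hnum : ∏ w : Fin (ℓ + 1), c * g w = c ^ (ℓ + 1) * ∏ w, g w := by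
    rw [Finset.prod_mul_distrib, Finset.prod_const, Finset.card_univ, Fintype.card_fin]
  have hden : ∏ e : SEdge σ, ∑ w ∈ (cellEdges σ hσ.1).span (Sum.inr e), c * g w =
      c ^ (ℓ + 1) * ∏ e : SEdge σ, ∑ w ∈ (cellEdges σ hσ.1).span (Sum.inr e), g w := by
    simp only [← Finset.mul_sum]
    rw [Finset.prod_mul_distrib, Finset.prod_const, Finset.card_univ, card_sEdge σ hσ]
  rw [hnum, hden, mul_div_mul_left _ _ (pow_ne_zero _ hc)]

/-- **Realisation**: every positive gap vector, normalised to total length `1`, is the gap vector of a point of the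
open simplex. -/
theorem exists_gapN_eq_div {g : Fin (ℓ + 1) → ℝ} (hg : ∀ w, 0 < g w) :
    ∃ t ∈ openSimplex ℓ, ∀ w : Fin (ℓ + 1), gapN t w = g w / ∑ w', g w' := by
  set S : ℝ := ∑ w', g w' with hS
  have hSpos : 0 < S := Finset.sum_pos (fun w _ => hg w) Finset.univ_nonempty
  set h : Fin ℓ → ℝ := fun j => g (Fin.castSucc j) / S with hh
  have hsumh : ∑ j, h j = (S - g (Fin.last ℓ)) / S := by
    simp only [hh, ← Finset.sum_div]
    congr 1
    rw [hS, Fin.sum_univ_castSucc]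
    ring
  refine ⟨cumsum h, ?_, fun w => ?_⟩
  · rw [← Set.mem_preimage, preimage_cumsum_openSimplex]
    refine ⟨fun j => div_pos (hg _) hSpos, ?_⟩
    rw [hsumh, div_lt_one hSpos]
    linarith [hg (Fin.last ℓ)]
  · rcases Nat.lt_or_ge w.val ℓ with hw | hw
    · have := gapN_cumsum_lt h ⟨w.val, hw⟩
      simp only at this
      rw [this]
      rfl
    · have hwl : w = Fin.last ℓ := Fin.ext (by rw [Fin.val_last]; have := w.isLt; omega)
      rw [hwl, Fin.val_last, gapN_cumsum_last, hsumh]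
      field_simp
      ring

/-- **`gapF ≤ M_σ` on the open positive orthant** (bijective seating). -/
theorem gapF_le_fSup (hσ : Function.Bijective σ) {g : Fin (ℓ + 1) → ℝ} (hg : ∀ w, 0 < g w) :
    gapF σ hσ.1 g ≤ fSup σ := by
  obtain ⟨t, ht, htg⟩ := exists_gapN_eq_div hg
  have hSpos : 0 < ∑ w', g w' := Finset.sum_pos (fun w _ => hg w) Finset.univ_nonempty
  have : gapF σ hσ.1 g = fSigma σ t := by
    rw [fSigma_eq_gapF σ hσ ht]
    simp only [htg, div_eq_inv_mul]
    exact (gapF_smul σ hσ (inv_ne_zero hSpos.ne') g).symm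
  rw [this]
  exact fSigma_le_fSup σ hσ ht

/-! ### The one-gap variation and the scaling equations at a maximiser -/

/-- **A maximiser satisfies the scaling equations.**  If `f_σ(t) = M_σ` at a point of the open simplex (bijective
seating), then for every gap `w₀`: `Σ_{e : w₀ ∈ span e} gapN t w₀ / len_t(e) = 1`. -/
theorem isScaling_of_fSigma_eq_fSup (hσ : Function.Bijective σ) {t : Fin ℓ → ℝ} (ht : t ∈ openSimplex ℓ)
    (hmax : fSigma σ t = fSup σ) : IsScaling σ hσ.1 t := by
  classical
  intro w0
  set E := cellEdges σ hσ.1 with hE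
  set g : Fin (ℓ + 1) → ℝ := fun w => gapN t w with hgdef
  have hg : ∀ w, 0 < g w := (mem_openSimplex_iff_gapN t).1 ht
  set x0 : ℝ := g w0 with hx0def
  have hx0 : 0 < x0 := hg w0
  -- data of the one-variable function
  set a : SEdge σ → ℝ := fun e => if w0 ∈ E.span (Sum.inr e) then 1 else 0 with hadef
  set R : SEdge σ → ℝ := fun e => ∑ w ∈ (E.span (Sum.inr e)).erase w0, g w with hRdef
  set C : ℝ := ∑ w ∈ univ.erase w0, Real.log (g w) with hCdef
  have hR : ∀ e, 0 ≤ R e := fun e => Finset.sum_nonneg fun w _ => (hg w).le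
  -- the edge sums of the varied vector
  have hsumupd : ∀ (e : SEdge σ) (x : ℝ), ∑ w ∈ E.span (Sum.inr e), Function.update g w0 x w = a e * x + R e := by
    intro e x
    by_cases hw : w0 ∈ E.span (Sum.inr e)
    · rw [Finset.sum_update_of_mem hw, Finset.sdiff_singleton_eq_erase]
      simp only [hadef, hRdef, if_pos hw, one_mul]
    · have h1 : ∑ w ∈ E.span (Sum.inr e), Function.update g w0 x w = ∑ w ∈ E.span (Sum.inr e), g w :=
        Finset.sum_congr rfl fun w hw' => Function.update_of_ne (ne_of_mem_of_not_mem hw' hw) _ _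
      rw [h1]
      simp only [hadef, hRdef, if_neg hw, zero_mul, zero_add, Finset.erase_eq_of_notMem hw]
  have hlen : ∀ e : SEdge σ, a e * x0 + R e = E.len t (Sum.inr e) := by
    intro e
    rw [← hsumupd e x0, E.len_eq_sum_gap]
    refine Finset.sum_congr rfl fun w _ => ?_
    rw [hx0def, Function.update_eq_self]
  have hlenpos : ∀ e : SEdge σ, 0 < E.len t (Sum.inr e) := fun e => E.len_pos ht _
  have haxR : ∀ (e : SEdge σ) {x : ℝ}, 0 < x → 0 < a e * x + R e := by
    intro e x hx
    by_cases hw : w0 ∈ E.span (Sum.inr e)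
    · simp only [hadef, if_pos hw, one_mul]
      exact add_pos_of_pos_of_nonneg hx (hR e)
    · have : a e * x + R e = E.len t (Sum.inr e) := by
        rw [← hlen e]; simp only [hadef, if_neg hw, zero_mul]
      rw [this]; exact hlenpos e
  -- the one-variable function and its identification with `log gapF`
  set ψ : ℝ → ℝ := fun x => Real.log x + C - ∑ e : SEdge σ, Real.log (a e * x + R e) with hψdef
  have hψ : ∀ x : ℝ, 0 < x → ψ x = Real.log (gapF σ hσ.1 (Function.update g w0 x)) := by
    intro x hx
    have hupos : ∀ w, 0 < Function.update g w0 x w := fun w => by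
      rcases eq_or_ne w w0 with rfl | hne
      · rwa [Function.update_self]
      · rw [Function.update_of_ne hne]; exact hg w
    unfold gapF
    rw [Real.log_div (Finset.prod_pos fun w _ => hupos w).ne'
      (Finset.prod_pos fun e _ => Finset.sum_pos (fun w _ => hupos w) (E.span_nonempty _)).ne',
      Real.log_prod fun w _ => (hupos w).ne',
      Real.log_prod fun e _ => (Finset.sum_pos (fun w _ => hupos w) (E.span_nonempty _)).ne']
    have h1 : ∑ w, Real.log (Function.update g w0 x w) = Real.log x + C := by
      rw [Finset.sum_eq_add_sum_sdiff_singleton_of_mem (Finset.mem_univ w0), Function.update_self,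
        Finset.sdiff_singleton_eq_erase]
      congr 1
      exact Finset.sum_congr rfl fun w hw => by rw [Function.update_of_ne (Finset.ne_of_mem_erase hw)]
    have h2 : ∑ e : SEdge σ, Real.log (∑ w ∈ E.span (Sum.inr e), Function.update g w0 x w) =
        ∑ e : SEdge σ, Real.log (a e * x + R e) := Finset.sum_congr rfl fun e _ => by rw [hsumupd]
    rw [h1, h2]
  -- `ψ` has a local maximum at `x0`
  have hmaxψ : IsLocalMax ψ x0 := by
    refine Filter.eventually_of_mem (Ioi_mem_nhds hx0) fun x (hx : 0 < x) => ?_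
    rw [hψ x hx, hψ x0 hx0]
    refine Real.log_le_log (gapF_pos σ hσ.1 fun w => ?_) ?_
    · rcases eq_or_ne w w0 with rfl | hne
      · rwa [Function.update_self]
      · rw [Function.update_of_ne hne]; exact hg w
    · have hself : Function.update g w0 x0 = g := by rw [hx0def]; exact Function.update_eq_self w0 g
      rw [hself, ← fSigma_eq_gapF σ hσ ht, hmax]
      refine gapF_le_fSup σ hσ fun w => ?_
      rcases eq_or_ne w w0 with rfl | hne
      · rwa [Function.update_self]
      · rw [Function.update_of_ne hne]; exact hg w
  -- its derivative at `x0`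
  have hderiv : HasDerivAt ψ (x0⁻¹ - ∑ e : SEdge σ, a e / (a e * x0 + R e)) x0 := by
    have hsum : HasDerivAt (fun x => ∑ e : SEdge σ, Real.log (a e * x + R e))
        (∑ e : SEdge σ, a e / (a e * x0 + R e)) x0 := by
      refine HasDerivAt.fun_sum fun e _ => ?_
      have hlin : HasDerivAt (fun x => a e * x + R e) (a e * 1) x0 :=
        ((hasDerivAt_id x0).const_mul (a e)).add_const (R e)
      have := hlin.log (haxR e hx0).ne'
      simpa using this
    have h1 : HasDerivAt (fun x => Real.log x + C) x0⁻¹ x0 := (Real.hasDerivAt_log hx0.ne').add_const C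
    exact h1.sub hsum
  have hzero := hmaxψ.hasDerivAt_eq_zero hderiv
  -- read off the scaling equation
  have hS : ∑ e : SEdge σ, a e / (a e * x0 + R e) =
      ∑ e ∈ univ.filter (fun e : SEdge σ => w0 ∈ E.span (Sum.inr e)), 1 / E.len t (Sum.inr e) := by
    rw [Finset.sum_filter]
    refine Finset.sum_congr rfl fun e _ => ?_
    rw [hlen e]
    by_cases hw : w0 ∈ E.span (Sum.inr e)
    · simp only [hadef, if_pos hw]
    · simp only [hadef, if_neg hw, zero_div]
  rw [hS] at hzero
  have hinv : ∑ e ∈ univ.filter (fun e : SEdge σ => w0 ∈ E.span (Sum.inr e)), 1 / E.len t (Sum.inr e) = x0⁻¹ := by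
    linarith
  calc ∑ e ∈ univ.filter (fun e : SEdge σ => w0 ∈ E.span (Sum.inr e)), gapN t w0 / E.len t (Sum.inr e)
      = x0 * ∑ e ∈ univ.filter (fun e : SEdge σ => w0 ∈ E.span (Sum.inr e)), 1 / E.len t (Sum.inr e) := by
        rw [Finset.mul_sum]
        exact Finset.sum_congr rfl fun e _ => by rw [hx0def, hgdef, mul_one_div]
    _ = 1 := by rw [hinv, mul_inv_cancel₀ hx0.ne']

/-- A maximiser of `f_σ` on the open simplex is a scaling point. -/
theorem isScaling_of_isMaxOn (hσ : Function.Bijective σ) {t : Fin ℓ → ℝ} (ht : t ∈ openSimplex ℓ)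
    (hmax : IsMaxOn (fSigma σ) (openSimplex ℓ) t) : IsScaling σ hσ.1 t :=
  isScaling_of_fSigma_eq_fSup σ hσ ht ((isMaxOn_iff_fSigma_eq_fSup σ hσ ht).1 hmax)

/-- **Maximisers are exactly the scaling points** (bijective seating). -/
theorem isScaling_iff_fSigma_eq_fSup (hσ : Function.Bijective σ) {t : Fin ℓ → ℝ} (ht : t ∈ openSimplex ℓ) :
    IsScaling σ hσ.1 t ↔ fSigma σ t = fSup σ :=
  ⟨fSigma_eq_fSup_of_isScaling σ hσ ht, isScaling_of_fSigma_eq_fSup σ hσ ht⟩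

/-! ### Strong capacity duality for convergent seatings -/

/-- **Every bijective convergent seating has a scaling point.** -/
theorem exists_isScaling (hσ : Function.Bijective σ) (hc : Convergent σ) :
    ∃ t ∈ openSimplex ℓ, IsScaling σ hσ.1 t := by
  obtain ⟨t, ht, h⟩ := exists_fSigma_eq_fSup σ hσ hc
  exact ⟨t, ht, isScaling_of_fSigma_eq_fSup σ hσ ht h⟩

/-- **Strong capacity duality.**  For a bijective convergent seating there is an admissible real transport plan —
non-negative, supported on (finite `σδ⁰`-edge, spanned gap), unit row sums on the finite edges, unit column sums —
whose entropy bound is attained: `∏_{i,w} x^x = M_σ`.  With weak duality (`fSup_le_of_realTransport`), `M_σ` is the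
MINIMUM of `∏ x^x = e^{−H(x)}` over admissible plans. -/
theorem exists_realTransport_eq_fSup (hσ : Function.Bijective σ) (hc : Convergent σ) :
    ∃ x : Fin (ℓ + 3) → Fin (ℓ + 1) → ℝ, (∀ i w, 0 ≤ x i w) ∧
      (∀ i w, x i w ≠ 0 → ((σ i).val ≠ ℓ + 2 ∧ (σ (i + 1)).val ≠ ℓ + 2) ∧
        min (σ i).val (σ (i + 1)).val ≤ w.val ∧ w.val < max (σ i).val (σ (i + 1)).val) ∧
      (∀ i, ((σ i).val ≠ ℓ + 2 ∧ (σ (i + 1)).val ≠ ℓ + 2) → ∑ w, x i w = 1) ∧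
      (∀ w, ∑ i, x i w = 1) ∧
      ∏ i, ∏ w, x i w ^ x i w = fSup σ := by
  obtain ⟨t, ht, hS⟩ := exists_isScaling σ hσ hc
  exact ⟨pointPlan σ hσ.1 t, pointPlan_nonneg σ hσ.1 ht, pointPlan_supp σ hσ.1 t, pointPlan_row σ hσ.1 ht,
    pointPlan_col σ hσ.1 hS, prod_pointPlan_rpow_eq_fSup σ hσ ht hS⟩

/-- **Strong duality, entropy form**: `M_σ = exp(Σ_{i,w} x log x) = e^{−H(x)}` for some admissible plan `x`
(and `≤` for all of them, `fSup_le_exp_sum_mul_log`). -/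
theorem exists_realTransport_exp_eq_fSup (hσ : Function.Bijective σ) (hc : Convergent σ) :
    ∃ x : Fin (ℓ + 3) → Fin (ℓ + 1) → ℝ, (∀ i w, 0 ≤ x i w) ∧
      (∀ i w, x i w ≠ 0 → ((σ i).val ≠ ℓ + 2 ∧ (σ (i + 1)).val ≠ ℓ + 2) ∧
        min (σ i).val (σ (i + 1)).val ≤ w.val ∧ w.val < max (σ i).val (σ (i + 1)).val) ∧
      (∀ i, ((σ i).val ≠ ℓ + 2 ∧ (σ (i + 1)).val ≠ ℓ + 2) → ∑ w, x i w = 1) ∧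
      (∀ w, ∑ i, x i w = 1) ∧
      Real.exp (∑ i, ∑ w, x i w * Real.log (x i w)) = fSup σ := by
  obtain ⟨x, hx, hsupp, hrow, hcol, hval⟩ := exists_realTransport_eq_fSup σ hσ hc
  refine ⟨x, hx, hsupp, hrow, hcol, ?_⟩
  rw [← hval, Real.exp_sum]
  refine Finset.prod_congr rfl fun i _ => ?_
  rw [Real.exp_sum]
  exact Finset.prod_congr rfl fun w _ => (rpow_self_eq_exp_mul_log (hx i w)).symm

end Summit.KontsevichZagierPeriods.Zeta5Search.Families.Cellular
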